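import Summits.NavierStokesRegularity.NavierStokesRegularity.Theorems.ExtremiserTransienceTwoThirdsScaleAverage
import HarnessLib

/-!
# Route `ExtremiserTransience`, crux `NearExtremalTransiencePerFlow` (stmt-NavierStokesRegularity-26567),
# LINE g10-1 «two_thirds» (ns-idea-10), stub S1a′ — BRICK 2, step (E2a): TOOLS FOR THE AVERAGED EXCESS MAJORANT

`--supports stmt-NavierStokesRegularity-26567` (helper; prover seat ns-net-p2 g13).  Bookkeeping for `excess_majorant`
(file `ExtremiserTransienceTwoThirdsExcessMajorant`): a finite sum over points of a lattice translate is bounded by the lattice sum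
(`sum_le_tsum_translate`); the layer volume `vol B(0,ρ⁸+ρ⁷) − vol B(0,ρ⁸) ≤ (7/(8ρ))·(8ρ²⁴ vol B₁)` and the fat-ball volume
`vol B(0,4ρ⁸) = 8·(8ρ²⁴ vol B₁)` against the cell cube; the `μ_b`-layer identity in `ℝ≥0∞`; and the rate bookkeeping `rate_le`
(all coefficients of the averaged majorant are `≤ C_e (t + 1/(tρ))` for `ρ ≥ 2`, `0 < t ≤ 1`).
HONEST FRAMING: measure/volume/real-arithmetic bookkeeping; nothing about Navier–Stokes is proved; no summit is proved by a line. [folklore]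
-/

noncomputable section

open scoped Topology InnerProductSpace RealInnerProductSpace ENNReal NNReal ContDiff
open MeasureTheory Filter Set Metric
open Literature.Analysis.FluidPDE
open Summit.NavierStokesRegularity.NavierStokesRegularity.Theorems.DepletionLadder.KStar.HalfSpace
open Summit.NavierStokesRegularity.NavierStokesRegularity.Theorems.DepletionLadder.KStar.BangBang
open Summit.NavierStokesRegularity.NavierStokesRegularity.Theorems.NearExtremalTransiencePerFlow.LocalMaximiser

namespace Summit.NavierStokesRegularity.NavierStokesRegularity.Theorems.NearExtremalTransiencePerFlow.TwoThirds

-- the summit's namespace repeats the problem name by convention (D-0017)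
set_option linter.dupNamespace false

/-! ## Finite sub-packings of a lattice translate -/

/-- A finite sum over points of the translate `Λ + τ` is bounded by the lattice sum. [folklore] -/
theorem sum_le_tsum_translate (Λ : AddSubgroup E3) (τ : E3) (F : Finset E3) (hF : ∀ c ∈ F, c - τ ∈ Λ) (f : E3 → ℝ≥0∞) :
    ∑ c ∈ F, f c ≤ ∑' g : Λ, f ((g : E3) + τ) := by
  classical
  obtain ⟨e, he⟩ : ∃ e : {c // c ∈ F} → Λ, e = fun c => ⟨c.1 - τ, hF c.1 c.2⟩ := ⟨_, rfl⟩
  have hinj : Function.Injective e := by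
    intro a b h
    have h' : (e a : E3) = (e b : E3) := by rw [h]
    simp only [he] at h'
    exact Subtype.ext (sub_left_injective h')
  calc ∑ c ∈ F, f c = ∑ c : {c // c ∈ F}, f c.1 := (Finset.sum_coe_sort F f).symm
    _ = ∑ c : {c // c ∈ F}, f ((e c : E3) + τ) := Finset.sum_congr rfl fun c _ => by simp only [he, sub_add_cancel]
    _ = ∑ g ∈ Finset.univ.map ⟨e, hinj⟩, f ((g : E3) + τ) := by rw [Finset.sum_map]; rfl
    _ ≤ ∑' g : Λ, f ((g : E3) + τ) := ENNReal.sum_le_tsum _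

/-! ## Volumes -/

/-- The layer volume against the cell cube: `vol B(0, ρ⁸+ρ⁷) − vol B(0, ρ⁸) ≤ (7/(8ρ)) · (8ρ²⁴ vol B₁)`. [folklore] -/
theorem layer_volume_le {ρ : ℝ} (hρ : 2 ≤ ρ) :
    volume (ball (0 : E3) (ρ ^ 8 + ρ ^ 7)) - volume (ball (0 : E3) (ρ ^ 8)) ≤
      ENNReal.ofReal (7 / (8 * ρ)) * (ENNReal.ofReal (8 * (ρ ^ 8) ^ 3) * volume (ball (0 : E3) 1)) := by
  have hρ0 : 0 < ρ := by linarith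
  have hV1 : volume (ball (0 : E3) 1) ≠ ⊤ := measure_ball_lt_top.ne
  have hd : (ρ ^ 8 + ρ ^ 7) ^ 3 - (ρ ^ 8) ^ 3 ≤ 7 / (8 * ρ) * (8 * (ρ ^ 8) ^ 3) := by
    have h1 : ρ ^ 22 ≤ ρ ^ 23 := pow_le_pow_right₀ (by linarith) (by norm_num)
    have h2 : ρ ^ 21 ≤ ρ ^ 23 := pow_le_pow_right₀ (by linarith) (by norm_num)
    have hid : 7 / (8 * ρ) * (8 * (ρ ^ 8) ^ 3) = 7 * ρ ^ 23 := by
      rw [show (8 : ℝ) * (ρ ^ 8) ^ 3 = (8 * ρ) * ρ ^ 23 by ring, ← mul_assoc, div_mul_cancel₀ _ (by positivity : (8 : ℝ) * ρ ≠ 0)]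
    rw [hid]; nlinarith
  have hL : volume (ball (0 : E3) (ρ ^ 8 + ρ ^ 7)) - volume (ball (0 : E3) (ρ ^ 8)) =
      ENNReal.ofReal ((ρ ^ 8 + ρ ^ 7) ^ 3 - (ρ ^ 8) ^ 3) * volume (ball (0 : E3) 1) := by
    rw [Measure.addHaar_ball_of_pos volume _ (by positivity : (0 : ℝ) < ρ ^ 8 + ρ ^ 7),
      Measure.addHaar_ball_of_pos volume _ (by positivity : (0 : ℝ) < ρ ^ 8), finrank_euclideanSpace, Fintype.card_fin,
      ← ENNReal.sub_mul (fun _ _ => hV1), ← ENNReal.ofReal_sub _ (by positivity)]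
  rw [hL, ← mul_assoc, ← ENNReal.ofReal_mul (by positivity)]
  exact mul_le_mul' (ENNReal.ofReal_le_ofReal hd) le_rfl

/-- The fat-ball volume against the cell cube: `vol B(0, 4ρ⁸) − vol B(0, 0) = 8 · (8ρ²⁴ vol B₁)`. [folklore] -/
theorem fat_volume_eq {ρ : ℝ} (hρ : 2 ≤ ρ) :
    volume (ball (0 : E3) (4 * ρ ^ 8)) - volume (ball (0 : E3) 0) = ENNReal.ofReal 8 * (ENNReal.ofReal (8 * (ρ ^ 8) ^ 3) * volume (ball (0 : E3) 1)) := by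
  have hρ0 : 0 < ρ := by linarith
  rw [Metric.ball_zero, measure_empty, tsub_zero, Measure.addHaar_ball_of_pos volume _ (by positivity : (0 : ℝ) < 4 * ρ ^ 8),
    finrank_euclideanSpace, Fintype.card_fin, ← mul_assoc, ← ENNReal.ofReal_mul (by norm_num)]
  congr 2
  ring

/-! ## The rate bookkeeping -/

/-- All coefficients of the averaged majorant are `≤ C_e (t + 1/(tρ))` (`ρ ≥ 2`, `0 < t ≤ 1`). [folklore] -/
theorem rate_le {κ Cc A₁ cth ρ t : ℝ} (hκ : 0 ≤ κ) (hCc : 0 ≤ Cc) (hA₁ : 0 ≤ A₁) (hcth : 0 < cth) (hρ : 2 ≤ ρ) (ht : 0 < t) (ht1 : t ≤ 1) :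
    (κ * (Cc / ρ ^ 2) + κ * t + Cc / ρ ^ 2) +
      (6 * κ * (Cc / ρ ^ 2) ^ 2 + 12 * κ * (1 / (2 * t) + 1 / 2) * (Cc / ρ ^ 2)) * (18 + 1 / cth) +
      2 * (κ * (Cc / ρ ^ 2) ^ 2 + 2 * κ * (1 / (2 * t) + 1 / 2) * (Cc / ρ ^ 2) + 2 * A₁ * (Cc / ρ ^ 2) + 2 * (Cc / ρ ^ 2) ^ 2) * (1 / cth) +
      7 / (8 * ρ) * 2 * (2 * (κ * (Cc / ρ ^ 2)) + 4 * κ * (1 / (2 * t) + 1 / 2) + 5 * A₁ + 4 * (Cc / ρ ^ 2)) ≤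
    (κ + κ * Cc + Cc + (6 * κ * Cc ^ 2 + 12 * κ * Cc) * (18 + 1 / cth) + (2 * κ * Cc ^ 2 + 4 * κ * Cc + 4 * A₁ * Cc + 4 * Cc ^ 2) * (1 / cth) +
      7 / 4 * (2 * κ * Cc + 4 * κ + 5 * A₁ + 4 * Cc)) * (t + 1 / (t * ρ)) := by
  have hρ0 : 0 < ρ := by linarith
  have hu : 0 ≤ 1 / (t * ρ) := by positivity
  -- basic comparisons with `u = 1/(tρ)`
  have f1 : 1 / ρ ≤ 1 / (t * ρ) := one_div_le_one_div_of_le (by positivity) (by nlinarith)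
  have f2 : 1 / ρ ≤ 1 := by rw [div_le_one hρ0]; linarith
  have f3 : 1 / ρ ^ 2 ≤ 1 / ρ := one_div_le_one_div_of_le hρ0 (by nlinarith)
  have hct : 1 / (2 * t) + 1 / 2 ≤ 1 / t := by
    have : 1 / 2 ≤ 1 / (2 * t) := one_div_le_one_div_of_le (by positivity) (by linarith)
    have h2 : 1 / (2 * t) + 1 / (2 * t) = 1 / t := by field_simp; ring
    linarith
  have hct0 : 0 ≤ 1 / (2 * t) + 1 / 2 := by positivity
  have hm : Cc / ρ ^ 2 = Cc * (1 / ρ ^ 2) := by ring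
  -- `m ≤ Cc u`
  have g1 : Cc / ρ ^ 2 ≤ Cc * (1 / (t * ρ)) := by rw [hm]; exact mul_le_mul_of_nonneg_left (f3.trans f1) hCc
  -- `m² ≤ Cc² u`
  have g2 : (Cc / ρ ^ 2) ^ 2 ≤ Cc ^ 2 * (1 / (t * ρ)) := by
    have h : (Cc / ρ ^ 2) ^ 2 = Cc ^ 2 * ((1 / ρ ^ 2) * (1 / ρ ^ 2)) := by ring
    rw [h]
    refine mul_le_mul_of_nonneg_left ?_ (sq_nonneg _)
    have h1 : 1 / ρ ^ 2 ≤ 1 := f3.trans f2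
    calc 1 / ρ ^ 2 * (1 / ρ ^ 2) ≤ 1 / ρ ^ 2 * 1 := mul_le_mul_of_nonneg_left h1 (by positivity)
      _ ≤ 1 / (t * ρ) := by rw [mul_one]; exact f3.trans f1
  -- `ct · m ≤ Cc u`
  have g3 : (1 / (2 * t) + 1 / 2) * (Cc / ρ ^ 2) ≤ Cc * (1 / (t * ρ)) := by
    calc (1 / (2 * t) + 1 / 2) * (Cc / ρ ^ 2) ≤ 1 / t * (Cc / ρ ^ 2) := mul_le_mul_of_nonneg_right hct (by positivity)
      _ = Cc * (1 / (t * ρ)) * (1 / ρ) := by field_simp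
      _ ≤ Cc * (1 / (t * ρ)) * 1 := mul_le_mul_of_nonneg_left f2 (by positivity)
      _ = Cc * (1 / (t * ρ)) := mul_one _
  -- `ct/ρ ≤ u`, `m/ρ ≤ Cc u`, `A₁/ρ ≤ A₁ u`
  have g4 : 7 / (8 * ρ) * 2 * (2 * (κ * (Cc / ρ ^ 2)) + 4 * κ * (1 / (2 * t) + 1 / 2) + 5 * A₁ + 4 * (Cc / ρ ^ 2)) ≤
      7 / 4 * (2 * κ * Cc + 4 * κ + 5 * A₁ + 4 * Cc) * (1 / (t * ρ)) := by
    have h74 : 7 / (8 * ρ) * 2 = 7 / 4 * (1 / ρ) := by ring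
    rw [h74]
    have hm1 : Cc / ρ ^ 2 ≤ Cc := by rw [hm]; exact (mul_le_mul_of_nonneg_left (f3.trans f2) hCc).trans (le_of_eq (mul_one _))
    have hin : 2 * (κ * (Cc / ρ ^ 2)) + 4 * κ * (1 / (2 * t) + 1 / 2) + 5 * A₁ + 4 * (Cc / ρ ^ 2) ≤
        (2 * κ * Cc + 5 * A₁ + 4 * Cc) + 4 * κ * (1 / t) := by
      have a := mul_le_mul_of_nonneg_left hm1 hκ
      have b := mul_le_mul_of_nonneg_left hct hκ
      have c := mul_le_mul_of_nonneg_left hm1 (by norm_num : (0 : ℝ) ≤ 4)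
      linarith
    have hstep : 1 / ρ * (2 * (κ * (Cc / ρ ^ 2)) + 4 * κ * (1 / (2 * t) + 1 / 2) + 5 * A₁ + 4 * (Cc / ρ ^ 2)) ≤
        (2 * κ * Cc + 5 * A₁ + 4 * Cc) * (1 / (t * ρ)) + 4 * κ * (1 / (t * ρ)) := by
      calc 1 / ρ * (2 * (κ * (Cc / ρ ^ 2)) + 4 * κ * (1 / (2 * t) + 1 / 2) + 5 * A₁ + 4 * (Cc / ρ ^ 2))
          ≤ 1 / ρ * ((2 * κ * Cc + 5 * A₁ + 4 * Cc) + 4 * κ * (1 / t)) := mul_le_mul_of_nonneg_left hin (by positivity)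
        _ = (2 * κ * Cc + 5 * A₁ + 4 * Cc) * (1 / ρ) + 4 * κ * (1 / (t * ρ)) := by field_simp
        _ ≤ (2 * κ * Cc + 5 * A₁ + 4 * Cc) * (1 / (t * ρ)) + 4 * κ * (1 / (t * ρ)) := by
            have := mul_le_mul_of_nonneg_left f1 (by positivity : 0 ≤ 2 * κ * Cc + 5 * A₁ + 4 * Cc)
            linarith
    calc 7 / 4 * (1 / ρ) * (2 * (κ * (Cc / ρ ^ 2)) + 4 * κ * (1 / (2 * t) + 1 / 2) + 5 * A₁ + 4 * (Cc / ρ ^ 2))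
        = 7 / 4 * (1 / ρ * (2 * (κ * (Cc / ρ ^ 2)) + 4 * κ * (1 / (2 * t) + 1 / 2) + 5 * A₁ + 4 * (Cc / ρ ^ 2))) := by ring
      _ ≤ 7 / 4 * ((2 * κ * Cc + 5 * A₁ + 4 * Cc) * (1 / (t * ρ)) + 4 * κ * (1 / (t * ρ))) := by gcongr
      _ = 7 / 4 * (2 * κ * Cc + 4 * κ + 5 * A₁ + 4 * Cc) * (1 / (t * ρ)) := by ring
  -- the groups
  have k1 : κ * (Cc / ρ ^ 2) ≤ κ * Cc * (1 / (t * ρ)) := by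
    have := mul_le_mul_of_nonneg_left g1 hκ; linarith
  have k2 : 6 * κ * (Cc / ρ ^ 2) ^ 2 + 12 * κ * (1 / (2 * t) + 1 / 2) * (Cc / ρ ^ 2) ≤ (6 * κ * Cc ^ 2 + 12 * κ * Cc) * (1 / (t * ρ)) := by
    have a := mul_le_mul_of_nonneg_left g2 (by positivity : 0 ≤ 6 * κ)
    have b := mul_le_mul_of_nonneg_left g3 (by positivity : 0 ≤ 12 * κ)
    linarith
  have k3 : 2 * κ * (Cc / ρ ^ 2) ^ 2 + 4 * κ * (1 / (2 * t) + 1 / 2) * (Cc / ρ ^ 2) + 4 * A₁ * (Cc / ρ ^ 2) + 4 * (Cc / ρ ^ 2) ^ 2 ≤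
      (2 * κ * Cc ^ 2 + 4 * κ * Cc + 4 * A₁ * Cc + 4 * Cc ^ 2) * (1 / (t * ρ)) := by
    have a := mul_le_mul_of_nonneg_left g2 (by positivity : 0 ≤ 2 * κ)
    have b := mul_le_mul_of_nonneg_left g3 (by positivity : 0 ≤ 4 * κ)
    have c := mul_le_mul_of_nonneg_left g1 (by positivity : 0 ≤ 4 * A₁)
    linarith
  have k2' := mul_le_mul_of_nonneg_right k2 (by positivity : 0 ≤ 18 + 1 / cth)
  have k3e : 2 * (κ * (Cc / ρ ^ 2) ^ 2 + 2 * κ * (1 / (2 * t) + 1 / 2) * (Cc / ρ ^ 2) + 2 * A₁ * (Cc / ρ ^ 2) + 2 * (Cc / ρ ^ 2) ^ 2) ≤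
      (2 * κ * Cc ^ 2 + 4 * κ * Cc + 4 * A₁ * Cc + 4 * Cc ^ 2) * (1 / (t * ρ)) := by linarith
  have k3' := mul_le_mul_of_nonneg_right k3e (by positivity : (0 : ℝ) ≤ 1 / cth)
  have hsum : (κ * (Cc / ρ ^ 2) + κ * t + Cc / ρ ^ 2) +
      (6 * κ * (Cc / ρ ^ 2) ^ 2 + 12 * κ * (1 / (2 * t) + 1 / 2) * (Cc / ρ ^ 2)) * (18 + 1 / cth) +
      2 * (κ * (Cc / ρ ^ 2) ^ 2 + 2 * κ * (1 / (2 * t) + 1 / 2) * (Cc / ρ ^ 2) + 2 * A₁ * (Cc / ρ ^ 2) + 2 * (Cc / ρ ^ 2) ^ 2) * (1 / cth) +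
      7 / (8 * ρ) * 2 * (2 * (κ * (Cc / ρ ^ 2)) + 4 * κ * (1 / (2 * t) + 1 / 2) + 5 * A₁ + 4 * (Cc / ρ ^ 2)) ≤
      κ * t + (κ * Cc + Cc + (6 * κ * Cc ^ 2 + 12 * κ * Cc) * (18 + 1 / cth) + (2 * κ * Cc ^ 2 + 4 * κ * Cc + 4 * A₁ * Cc + 4 * Cc ^ 2) * (1 / cth) +
        7 / 4 * (2 * κ * Cc + 4 * κ + 5 * A₁ + 4 * Cc)) * (1 / (t * ρ)) := by
    have e1 : (6 * κ * Cc ^ 2 + 12 * κ * Cc) * (1 / (t * ρ)) * (18 + 1 / cth) = (6 * κ * Cc ^ 2 + 12 * κ * Cc) * (18 + 1 / cth) * (1 / (t * ρ)) := by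
      ring
    rw [e1] at k2'
    linarith [k1, g1, k2', k3', g4]
  have hrest : 0 ≤ κ * Cc + Cc + (6 * κ * Cc ^ 2 + 12 * κ * Cc) * (18 + 1 / cth) + (2 * κ * Cc ^ 2 + 4 * κ * Cc + 4 * A₁ * Cc + 4 * Cc ^ 2) * (1 / cth) +
      7 / 4 * (2 * κ * Cc + 4 * κ + 5 * A₁ + 4 * Cc) := by positivity
  have p1 := mul_nonneg hκ hu
  have p2 := mul_nonneg hrest ht.le
  linarith [hsum, p1, p2]

/-! ## Layers of the measure `(|ω|² + |∇ω|²) dx` -/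

/-- `μ_b`-layers in `ℝ≥0∞`: `ofReal((Z+W)_{B(c,r')} − (Z+W)_{B(c,r)}) = μ_b(B(c,r')) − μ_b(B(c,r))`. [folklore] -/
theorem ofReal_layer_eq {w : E3 → E3} (hz : Integrable (zd w)) (hwd : Integrable (wd w)) (hw : ContDiff ℝ (⊤ : ℕ∞) w) (c : E3) {r r' : ℝ}
    (hrr' : r ≤ r') :
    ENNReal.ofReal ((Zb w c r' + Wb w c r') - (Zb w c r + Wb w c r)) =
      (volume.withDensity fun x => ENNReal.ofReal (zd w x + wd w x)) (ball c r') -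
        (volume.withDensity fun x => ENNReal.ofReal (zd w x + wd w x)) (ball c r) := by
  have hsub : ball c r ⊆ ball c r' := ball_subset_ball hrr'
  have hle : Zb w c r + Wb w c r ≤ Zb w c r' + Wb w c r' := by linarith [Zb_mono hw hsub, Wb_mono hw hsub]
  rw [ball_withDensity_eq hz hwd, ball_withDensity_eq hz hwd,
    ENNReal.ofReal_sub _ (add_nonneg (Zb_nonneg _ _ _) (Wb_nonneg _ _ _))]

end Summit.NavierStokesRegularity.NavierStokesRegularity.Theorems.NearExtremalTransiencePerFlow.TwoThirds

end
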